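import Summits.ResolutionOfSingularities.ResolutionOfSingularities.Theorems.WeightedInvariantELadderOneRung
import Summits.ResolutionOfSingularities.ResolutionOfSingularities.Theorems.AQSHeightTwoCentreHolds
import HarnessLib

/-!
# e-ladder rung `e = 1` of the door `HypersurfaceCentreConstruction`, modulo the separable-base-change clause ONLY

Topic: `Summits/ResolutionOfSingularities/ResolutionOfSingularities/Theorems`. Helper for the door item
`HypersurfaceCentreConstruction` (statement `stmt-ResolutionOfSingularities-19897`, route `WeightedInvariant`), line `local-engine`,
RUNG `e = 1` (res-D-pv-025 AS stub-10, `ELadderOne.admissiblyResolvableDim_one_of_AQS`, p520391) combined with ORDER (o25)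
«F-AQS-T in the kernel» (res-L1-w43-plan-1 2026-08-27T09:19:49Z; assembly `AQSHeightTwo.AbramovichQuekSchober2025_heightTwoCentre_holds`,
res-type-092 and the (o25) team): the rung's FIRST named hypothesis `hAQS₁ : AbramovichQuekSchober2025_heightTwoCentre` is now a
tree theorem, so the rung holds modulo `hAQS₂ : AbramovichQuekSchober2025_separableBaseChange` alone ((o25-δ), res-D-pv-025, in
progress).

[OURS · L1 W4.3] Two-line corollaries; nothing here is a claim about Hironaka's manuscript; AI work, weaker than expert review.
[cite: AbramovichQuekSchober2025, Thm 1.3 (1)(3), Thm 3.5]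
-/

noncomputable section

open Literature.AlgebraicGeometry.Resolution
open Summit.ResolutionOfSingularities.ResolutionOfSingularities.Cruxes.HypersurfaceCentreConstruction

set_option linter.dupNamespace false -- mandated namespace of this single-conjunct summit

namespace Summit.ResolutionOfSingularities.ResolutionOfSingularities.Theorems.ELadderOne

/-- **Rung `e = 1` modulo separable base change only**: hypersurfaces of dimension `1` in smooth varieties over a perfect field of
characteristic `p` are admissibly resolvable, GIVEN `AbramovichQuekSchober2025_separableBaseChange` (the clause (o25-δ) is
discharging) — `hAQS₁` is supplied by `AQSHeightTwo.AbramovichQuekSchober2025_heightTwoCentre_holds`.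
[cite: AbramovichQuekSchober2025, Thm 1.3 (1)(3), Thm 3.5] -/
theorem admissiblyResolvableDim_one_of_separableBaseChange (hAQS₂ : AbramovichQuekSchober2025_separableBaseChange) (p : ℕ) :
    AdmissiblyResolvableDim p 1 :=
  admissiblyResolvableDim_one_of_AQS AQSHeightTwo.AbramovichQuekSchober2025_heightTwoCentre_holds hAQS₂ p

/-- … and the corresponding centre choice in dimension `1`. [cite: AbramovichQuekSchober2025, Thm 1.3 (1)(3), Thm 3.5] -/
theorem nonempty_choiceDim_one_of_separableBaseChange (hAQS₂ : AbramovichQuekSchober2025_separableBaseChange) (p : ℕ) :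
    Nonempty (HypersurfaceCentreChoiceDim p 1) :=
  nonempty_choiceDim_one_of_AQS AQSHeightTwo.AbramovichQuekSchober2025_heightTwoCentre_holds hAQS₂ p

end Summit.ResolutionOfSingularities.ResolutionOfSingularities.Theorems.ELadderOne

end
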